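import Summits.CriticalPhenomena.PercolationContinuityZ3.Theorems.Transplant.SiteKNLevels
import Literature.Probability.Percolation.SitePaths
import Literature.Probability.LatticeModels.ProdBernoulliIndependence
import HarnessLib

/-!
# SITE Kozma–Nitzan §4, Lemma 10 — part 3: Step III, seeds behind far-apart contact vertices
# (site twin of `L/KozmaNitzanTargetLemma.lean` ll. 1272–1660)

builds on p205010 (kernel theorem, internal audit signed; external expert review pending).
Lane `prim-bschramm`, class C1a (site percolation on `ℤ³`), seat p1 gen 3, block (α) of the SITE same-`p` witness
(`SiteSameP.SiteSamePWitnessZd`, socket p217536).  Helper file (`--supports stmt-CriticalPhenomena-4575`).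

SITE SEEDS.  In the bond proof the seed of a contact vertex `x = y + σe_i` is a set of EDGES (the window region
`wreg`, the inward edges to the face `U(P)`, the contact edge).  For site percolation the contact vertex `x` is already
open (it lies in the cluster of `o`) and the seed is the VERTEX set `wreg(x)` — the `(d−1)`-dimensional window of
half-side `M + 1` around `y` in the boundary layer of `B⟨j⟩`.  It lies in `B⟨j⟩` (fresh vertices of weight `p`, off the
region outside `B⟨j⟩`) and OUTSIDE the shrunken box `Icc (Lo+1) (Hi−1)` (so it is untouched by the pinning of the
shell `S` in Step V); the face `U(P)` itself is one layer further in and is NOT part of the site seed — the good vertex of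
Step IV supplies its own openness (it is pinned open).  Everything geometric (`winData`, `ufaceX`, `vX`, `Rsep`, `Ncont`,
`selOf`, `wreg`, …) is REUSED from the bond files.

* `sSeed`, `sSel`, `sSeedOpen`, `sOSeed`, `sGev` (`𝒢`), `sFx` (first-index decomposition), their locality
  (`sOSeed_congr`, `determinedBy_sFx`, `measurableSet_sFx`) and disjointness;
* `SLHyp.le_real_sSeedOpen` — a site seed is open with probability `≥ p^{siteSeedBound d M}`;
* **`SLHyp.real_manyContacts_diff_sGev_le`** — (19): with `≥ Ncont d M k` contacts, no selected open seed has
  probability `≤ (1 − p^{siteSeedBound d M})^k`;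
* `siteConn_of_mem_sOSeed` — on `sOSeed x`, `o` is joined by open vertices to every OPEN vertex of the face `U(P)`.
[cite: KozmaNitzan2024, §4 pp. 19–21 (Step III, (19)–(20))]
-/

noncomputable section

namespace Summit.CriticalPhenomena.PercolationContinuityZ3.Theorems.Transplant

namespace SiteKN

open MeasureTheory ProbabilityTheory
open Literature.Probability.Percolation Literature.Probability.LatticeModels
open Literature.Probability.Percolation.KozmaNitzan
open SiteTransplant (siteConn mem_siteConn)

variable {d : ℕ}

/-! ## Site seeds -/

/-- **The site seed** of the contact vertex `x` at level `j`: the window region `wreg` around its inner neighbour `y` in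
the boundary layer of `B⟨j⟩`. [cite: KozmaNitzan2024, §4 p. 19 (seeds)] -/
def sSeed [NeZero d] (L : LData d) (j M : ℕ) (x : Site d) : Finset (Site d) :=
  wreg (L.Lo j) (L.Hi j) M (L.winData j M x).1 (L.winData j M x).2.2

/-- A bound for the number of seed vertices, depending only on `d` and `M`. [folklore] -/
def siteSeedBound (d M : ℕ) : ℕ := (2 * M + 3) ^ d

/-- The selected contact vertices at level `j` (site). [cite: KozmaNitzan2024, §4 p. 19 (P_1, …, P_k)] -/
def sSel (L : LData d) (j M k : ℕ) (ω : SiteConfig (Site d)) : Finset (Site d) := LData.selOf M k (sKont L j ω)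

/-- All seed vertices of `x` are open. [cite: KozmaNitzan2024, §4 p. 19 (seed)] -/
def sSeedOpen [NeZero d] (L : LData d) (j M : ℕ) (x : Site d) : Set (SiteConfig (Site d)) :=
  {ω | ↑(sSeed L j M x) ⊆ ω}

/-- `x` is a selected contact vertex whose site seed is open. [cite: KozmaNitzan2024, §4 p. 19 (the events F_P)] -/
def sOSeed [NeZero d] (L : LData d) (j M k : ℕ) (x : Site d) : Set (SiteConfig (Site d)) :=
  {ω | x ∈ sSel L j M k ω} ∩ sSeedOpen L j M x

/-- `𝒢` (site): some selected contact vertex has an open seed. [cite: KozmaNitzan2024, §4 p. 19 ((19))] -/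
def sGev [NeZero d] (L : LData d) (j M k : ℕ) : Set (SiteConfig (Site d)) :=
  ⋃ x ∈ outerBoundary (zdGraph d) (L.X j), sOSeed L j M k x

open Classical in
/-- `F_x` (site): `x` is the FIRST selected contact vertex with an open seed. [cite: KozmaNitzan2024, §4 p. 19] -/
def sFx [NeZero d] (L : LData d) (j M k : ℕ) (x : Site d) : Set (SiteConfig (Site d)) :=
  sOSeed L j M k x ∩ ⋂ x' ∈ (outerBoundary (zdGraph d) (L.X j)).filter
    (fun x' => Encodable.encode x' < Encodable.encode x), (sOSeed L j M k x')ᶜ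

variable {L : LData d}

/-- Selected contacts are contacts. [folklore] -/
theorem sSel_subset_sKont {j M k : ℕ} (ω : SiteConfig (Site d)) : sSel L j M k ω ⊆ sKont L j ω :=
  LData.selOf_subset _

/-- Seed vertices: in `B⟨j⟩`, outside the shrunken box, and within sup-distance `Rsep M` of the contact vertex. [folklore] -/
theorem mem_sSeed [NeZero d] {j M : ℕ} (hwide : ∀ k, L.Lo j k + 2 * M + 2 ≤ L.Hi j k) {x : Site d}
    (hx : x ∈ outerBoundary (zdGraph d) (L.X j)) {z : Site d} (hz : z ∈ sSeed L j M x) :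
    z ∈ L.X j ∧ z ∉ Finset.Icc (L.Lo j + 1) (L.Hi j - 1) ∧ z - x ∈ box d (LData.Rsep M) := by
  obtain ⟨h, hxy⟩ := LData.winData_spec hwide hx
  refine ⟨by rw [LData.X_eq]; exact wreg_subset_Icc h hz, not_mem_shrink_of_mem_wreg h hz, ?_⟩
  rw [mem_box]
  intro k
  have := abs_sub_contact_le_of_mem_wreg h (σ := (L.winData j M x).2.1) hz k
  rw [← hxy] at this
  rw [abs_le] at this
  simp only [Pi.sub_apply, LData.Rsep]; push_cast; omega

/-- The number of seed vertices is at most `siteSeedBound d M`. [folklore] -/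
theorem card_sSeed_le [NeZero d] (j M : ℕ) (x : Site d) : (sSeed L j M x).card ≤ siteSeedBound d M := by
  unfold sSeed wreg siteSeedBound
  refine card_Icc_le_pow fun k => ?_
  rcases eq_or_ne k (L.winData j M x).1 with rfl | hk
  · simp only [Function.update_self]; omega
  · simp only [Function.update_of_ne hk, Pi.add_apply, Pi.sub_apply, Pi.natCast_apply]
    push_cast; omega

/-- Far-apart contact vertices have disjoint site seeds. [cite: KozmaNitzan2024, §4 p. 19] -/
theorem sSeed_disjoint [NeZero d] {j M : ℕ} (hwide : ∀ k, L.Lo j k + 2 * M + 2 ≤ L.Hi j k) {x x' : Site d}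
    (hx : x ∈ outerBoundary (zdGraph d) (L.X j)) (hx' : x' ∈ outerBoundary (zdGraph d) (L.X j))
    (hfar : x' - x ∉ box d (2 * LData.Rsep M)) : Disjoint (sSeed L j M x) (sSeed L j M x') := by
  rw [Finset.disjoint_left]
  intro z hz hz'
  have h1 := (mem_sSeed hwide hx hz).2.2
  have h2 := (mem_sSeed hwide hx' hz').2.2
  apply hfar
  rw [mem_box] at h1 h2 ⊢
  intro k
  have a1 := h1 k; have a2 := h2 k
  simp only [Pi.sub_apply] at a1 a2 ⊢
  push_cast at a1 a2 ⊢
  omega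

/-! ## The first-index decomposition -/

/-- `F_x ⊆ sOSeed x`. [folklore] -/
theorem sFx_subset_sOSeed [NeZero d] {j M k : ℕ} (x : Site d) : sFx L j M k x ⊆ sOSeed L j M k x :=
  Set.inter_subset_left

/-- The events `F_x` are pairwise disjoint. [cite: KozmaNitzan2024, §4 p. 19 ("These events are disjoint")] -/
theorem sFx_disjoint [NeZero d] {j M k : ℕ} {x x' : Site d} (hne : x ≠ x')
    (hx' : x' ∈ outerBoundary (zdGraph d) (L.X j)) (hx : x ∈ outerBoundary (zdGraph d) (L.X j)) :
    Disjoint (sFx L j M k x) (sFx L j M k x') := by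
  classical
  have hne' : Encodable.encode x ≠ Encodable.encode x' := fun h => hne (Encodable.encode_injective h)
  rw [Set.disjoint_left]
  rintro ω ⟨hωx, hIx⟩ ⟨hωx', hIx'⟩
  simp only [Set.mem_iInter, Finset.mem_filter, Set.mem_compl_iff] at hIx hIx'
  rcases lt_or_gt_of_ne hne' with hlt | hlt
  · exact hIx' x ⟨hx, hlt⟩ hωx
  · exact hIx x' ⟨hx', hlt⟩ hωx'

/-- `⋃_x F_x = 𝒢`. [cite: KozmaNitzan2024, §4 p. 19 ((20))] -/
theorem biUnion_sFx_eq_sGev [NeZero d] (j M k : ℕ) :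
    ⋃ x ∈ outerBoundary (zdGraph d) (L.X j), sFx L j M k x = sGev L j M k := by
  classical
  ext ω
  simp only [sGev, Set.mem_iUnion, exists_prop]
  constructor
  · rintro ⟨x, hx, hF⟩; exact ⟨x, hx, sFx_subset_sOSeed x hF⟩
  · rintro ⟨x, hx, hωx⟩
    obtain ⟨x₀, hx₀, hmin⟩ := Finset.exists_min_image
      ((outerBoundary (zdGraph d) (L.X j)).filter fun x' => ω ∈ sOSeed L j M k x') Encodable.encode
      ⟨x, Finset.mem_filter.2 ⟨hx, hωx⟩⟩
    obtain ⟨hx₀O, hωx₀⟩ := Finset.mem_filter.1 hx₀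
    refine ⟨x₀, hx₀O, hωx₀, ?_⟩
    simp only [Set.mem_iInter, Finset.mem_filter, Set.mem_compl_iff]
    rintro x' ⟨hx'O, hlt⟩ hωx'
    exact absurd (hmin x' (Finset.mem_filter.2 ⟨hx'O, hωx'⟩)) (not_le.2 hlt)

/-! ## Locality -/

/-- `sOSeed x` is determined by the region outside `B⟨j⟩` and the seed of `x`; in particular it is unaffected by the
states of the vertices of any `S ⊆ Icc (Lo+1) (Hi−1)`. [cite: KozmaNitzan2024, §4 p. 21 ("P_{K_ξ}(F_P) = P_G(F_P)")] -/
theorem sOSeed_congr [NeZero d] {j M k : ℕ} (hwide : ∀ k, L.Lo j k + 2 * M + 2 ≤ L.Hi j k)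
    {S : Finset (Site d)} (hS : S ⊆ Finset.Icc (L.Lo j + 1) (L.Hi j - 1)) {x : Site d}
    (hx : x ∈ outerBoundary (zdGraph d) (L.X j)) {ω ω' : SiteConfig (Site d)}
    (h : ∀ v ∉ S, v ∈ ω ↔ v ∈ ω') : ω ∈ sOSeed L j M k x ↔ ω' ∈ sOSeed L j M k x := by
  have hSX : S ⊆ L.X j := hS.trans (by
    intro u hu; rw [LData.X_eq, mem_Icc_iff]; rw [mem_Icc_iff] at hu; intro k'; have := hu k'
    simp only [Pi.add_apply, Pi.sub_apply, Pi.one_apply] at this; omega)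
  have hreg : ω ∩ L.region j = ω' ∩ L.region j := by
    ext v
    simp only [Set.mem_inter_iff]
    constructor
    · rintro ⟨hv, hr⟩; exact ⟨(h v fun hvS => hr.1 (Finset.mem_coe.2 (hSX hvS))).1 hv, hr⟩
    · rintro ⟨hv, hr⟩; exact ⟨(h v fun hvS => hr.1 (Finset.mem_coe.2 (hSX hvS))).2 hv, hr⟩
  have hseed : ∀ z ∈ sSeed L j M x, z ∈ ω ↔ z ∈ ω' := fun z hz =>
    h z fun hzS => (mem_sSeed hwide hx hz).2.1 (hS hzS)
  simp only [sOSeed, Set.mem_inter_iff, Set.mem_setOf_eq, sSel, sKont_congr hreg, sSeedOpen]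
  refine and_congr_right fun _ => ⟨fun h' z hz => (hseed z hz).1 (h' hz), fun h' z hz => (hseed z hz).2 (h' hz)⟩

open Classical in
/-- Same for `F_x`. [cite: KozmaNitzan2024, §4 p. 21] -/
theorem sFx_congr [NeZero d] {j M k : ℕ} (hwide : ∀ k, L.Lo j k + 2 * M + 2 ≤ L.Hi j k)
    {S : Finset (Site d)} (hS : S ⊆ Finset.Icc (L.Lo j + 1) (L.Hi j - 1)) {x : Site d}
    (hx : x ∈ outerBoundary (zdGraph d) (L.X j)) {ω ω' : SiteConfig (Site d)}
    (h : ∀ v ∉ S, v ∈ ω ↔ v ∈ ω') : ω ∈ sFx L j M k x ↔ ω' ∈ sFx L j M k x := by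
  simp only [sFx, Set.mem_inter_iff, Set.mem_iInter, Set.mem_compl_iff, Finset.mem_filter]
  rw [sOSeed_congr hwide hS hx h]
  refine and_congr_right fun _ => forall₂_congr fun x' hx' => ?_
  rw [sOSeed_congr hwide hS hx'.1 h]

/-- `F_x` is determined by the complement of `S`. [cite: KozmaNitzan2024, §4 p. 21] -/
theorem determinedBy_sFx [NeZero d] {j M k : ℕ} (hwide : ∀ k, L.Lo j k + 2 * M + 2 ≤ L.Hi j k)
    {S : Finset (Site d)} (hS : S ⊆ Finset.Icc (L.Lo j + 1) (L.Hi j - 1)) {x : Site d}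
    (hx : x ∈ outerBoundary (zdGraph d) (L.X j)) : DeterminedBy (sFx L j M k x) (↑S : Set (Site d))ᶜ := by
  rw [determinedBy_iff]
  intro ω ω' hω
  refine sFx_congr hwide hS hx fun v hv => ?_
  have := Set.ext_iff.1 hω v
  simp only [Set.mem_inter_iff, Set.mem_compl_iff, Finset.mem_coe, hv, not_false_eq_true, and_true] at this
  exact this

/-- `sOSeed x'` is determined by the finite set `Sfin ∪ ⋃ seeds`. [folklore] -/
theorem determinedBy_sOSeed [NeZero d] {j M k : ℕ} {x' : Site d} (hx' : x' ∈ outerBoundary (zdGraph d) (L.X j)) :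
    DeterminedBy (sOSeed L j M k x')
      ↑(L.Sfin ∪ (outerBoundary (zdGraph d) (L.X j)).biUnion fun x => sSeed L j M x) := by
  classical
  rw [determinedBy_iff]
  intro ω ω' hω
  have hag : ∀ v ∈ L.Sfin ∪ (outerBoundary (zdGraph d) (L.X j)).biUnion (fun x => sSeed L j M x),
      v ∈ ω ↔ v ∈ ω' := fun v hv => by
    have := Set.ext_iff.1 hω v
    simp only [Set.mem_inter_iff, Finset.mem_coe, hv, and_true] at this
    exact this
  have hreg : ω ∩ L.region j = ω' ∩ L.region j := by
    ext v; simp only [Set.mem_inter_iff]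
    constructor
    · rintro ⟨hv, hr⟩; exact ⟨(hag v (Finset.mem_union_left _ (Finset.mem_coe.1 hr.2))).1 hv, hr⟩
    · rintro ⟨hv, hr⟩; exact ⟨(hag v (Finset.mem_union_left _ (Finset.mem_coe.1 hr.2))).2 hv, hr⟩
  simp only [sOSeed, Set.mem_inter_iff, Set.mem_setOf_eq, sSel, sKont_congr hreg, sSeedOpen]
  refine and_congr_right fun _ => ⟨fun h' z hz => ?_, fun h' z hz => ?_⟩
  · exact (hag z (Finset.mem_union_right _ (Finset.mem_biUnion.2 ⟨x', hx', hz⟩))).1 (h' hz)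
  · exact (hag z (Finset.mem_union_right _ (Finset.mem_biUnion.2 ⟨x', hx', hz⟩))).2 (h' hz)

/-- `F_x` is measurable. [folklore] -/
theorem measurableSet_sFx [NeZero d] {j M k : ℕ} {x : Site d} (hx : x ∈ outerBoundary (zdGraph d) (L.X j)) :
    MeasurableSet (sFx L j M k x) := by
  classical
  set K := L.Sfin ∪ (outerBoundary (zdGraph d) (L.X j)).biUnion fun x' => sSeed L j M x' with hK
  have hF : DeterminedBy (sFx L j M k x) ↑K := by
    rw [determinedBy_iff]
    intro ω ω' hω
    simp only [sFx, Set.mem_inter_iff, Set.mem_iInter, Set.mem_compl_iff, Finset.mem_filter]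
    rw [(determinedBy_iff _ _).1 (determinedBy_sOSeed (M := M) (k := k) hx) ω ω' hω]
    refine and_congr_right fun _ => forall₂_congr fun x' hx' => ?_
    rw [(determinedBy_iff _ _).1 (determinedBy_sOSeed (M := M) (k := k) hx'.1) ω ω' hω]
  exact hF.measurableSet_of_finset

/-- `𝒢` is measurable. [folklore] -/
theorem measurableSet_sGev [NeZero d] (j M k : ℕ) : MeasurableSet (sGev L j M k) := by
  rw [← biUnion_sFx_eq_sGev]
  exact Finset.measurableSet_biUnion _ fun x hx => measurableSet_sFx hx

/-! ## On an open seed, `o` reaches the open vertices of the face -/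

/-- A lattice path inside a set of open vertices is an open-site path. [folklore] -/
theorem siteReachable_of_pathIn {A : Set (Site d)} {ω : SiteConfig (Site d)} (hA : A ⊆ ω) {a b : Site d}
    (hp : PathIn (zdGraph d) A a b) : (siteOpenGraph (zdGraph d) ω).Reachable a b := by
  obtain ⟨ha, hp⟩ := hp
  induction hp with
  | refl => exact SimpleGraph.Reachable.refl _
  | @tail u v huv hv ih =>
    have hu : u ∈ A := (show PathIn (zdGraph d) A a u from ⟨ha, huv⟩).right_mem
    refine ih.trans (SimpleGraph.Adj.reachable ?_)
    rw [siteOpenGraph_adj]; exact ⟨hv.1, hA hu, hA hv.2⟩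

/-- **On `sOSeed x`, `o` is joined by open vertices to every OPEN vertex `u` of the face behind `x`** (through the
contact vertex `x`, the open window region, and the inward step at `u + σe_i`).
[cite: KozmaNitzan2024, §4 p. 21 ("hence o connects to A_ξ")] -/
theorem siteConn_of_mem_sOSeed [NeZero d] {j M k : ℕ} (hwide : ∀ k, L.Lo j k + 2 * M + 2 ≤ L.Hi j k)
    {x : Site d} (hx : x ∈ outerBoundary (zdGraph d) (L.X j)) {ω : SiteConfig (Site d)}
    (hω : ω ∈ sOSeed L j M k x) {u : Site d} (hu : u ∈ L.ufaceX j M x) (huω : u ∈ ω) :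
    ω ∈ siteConn (zdGraph d) L.o u := by
  obtain ⟨hsel, hseed⟩ := hω
  have hxK : x ∈ sKont L j ω := sSel_subset_sKont ω hsel
  obtain ⟨-, hox⟩ := mem_sKont_iff.1 hxK
  obtain ⟨hoω, hxω, _, _, hr⟩ := hox
  have hox' : (siteOpenGraph (zdGraph d) ω).Reachable L.o x := hr.map (SimpleGraph.Embedding.induce _).toHom
  obtain ⟨h, hxy⟩ := LData.winData_spec hwide hx
  set i := (L.winData j M x).1
  set σ := (L.winData j M x).2.1
  set y := (L.winData j M x).2.2
  have hz : u + σ • unitVec i ∈ plaq (L.Lo j) (L.Hi j) M i y := (mem_uface_iff).1 hu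
  -- `x ∼ y`, `y` open
  have hyω : y ∈ ω := hseed (Finset.mem_coe.2 (self_mem_wreg h))
  have h1 : (siteOpenGraph (zdGraph d) ω).Adj x y := by
    rw [siteOpenGraph_adj, hxy]
    exact ⟨((adj_iff_exists_sign.2 ⟨i, σ, h.sign, rfl⟩ : (zdGraph d).Adj y _).symm), hxy ▸ hxω, hyω⟩
  -- `y ↝ u + σ e_i` inside the open window region
  have h2 : (siteOpenGraph (zdGraph d) ω).Reachable y (u + σ • unitVec i) :=
    siteReachable_of_pathIn hseed (exists_pathIn_Icc (self_mem_wreg h) (plaq_subset_wreg hz))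
  -- the inward step
  have h3 : (siteOpenGraph (zdGraph d) ω).Adj (u + σ • unitVec i) u := by
    rw [siteOpenGraph_adj]
    refine ⟨?_, hseed (Finset.mem_coe.2 (plaq_subset_wreg hz)), huω⟩
    have : (zdGraph d).Adj u (u + σ • unitVec i) := adj_iff_exists_sign.2 ⟨i, σ, h.sign, rfl⟩
    exact this.symm
  exact ⟨hoω, huω, hox'.trans (h1.reachable.trans (h2.trans h3.reachable))⟩

namespace SLHyp

variable {w : Site d → unitInterval} {p : unitInterval} {D : Finset (Site d)} {R : ℕ}
variable (hL : SLHyp L w p D R)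
include hL

/-- Seed vertices carry weight `p`. [cite: KozmaNitzan2024, §4 p. 19] -/
theorem w_sSeed [NeZero d] {j M : ℕ} (hj : j ≤ R + 1) (hwide : ∀ k, L.Lo j k + 2 * M + 2 ≤ L.Hi j k)
    {x : Site d} (hx : x ∈ outerBoundary (zdGraph d) (L.X j)) {z : Site d} (hz : z ∈ sSeed L j M x) : w z = p :=
  hL.sub.inside z (hL.mem_D_of_mem_X hj (mem_sSeed hwide hx hz).1)

/-- **A site seed is open with probability at least `p^{siteSeedBound d M}`.** [cite: KozmaNitzan2024, §4 p. 19] -/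
theorem le_real_sSeedOpen [NeZero d] {j M : ℕ} (hj : j ≤ R + 1) (hwide : ∀ k, L.Lo j k + 2 * M + 2 ≤ L.Hi j k)
    {x : Site d} (hx : x ∈ outerBoundary (zdGraph d) (L.X j)) :
    (p : ℝ) ^ siteSeedBound d M ≤ (prodBernoulli w).real (sSeedOpen L j M x) := by
  unfold sSeedOpen
  rw [prodBernoulli_real_subset w (sSeed L j M x),
    Finset.prod_congr rfl fun z hz => by rw [hL.w_sSeed hj hwide hx hz], Finset.prod_const]
  exact pow_le_pow_of_le_one p.2.1 p.2.2 (card_sSeed_le j M x)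

open Classical in
/-- **Step III, (19)** (site): with `≥ Ncont d M k` contact vertices at level `j`, with probability at most
`(1 − p^{siteSeedBound d M})^k` no selected contact vertex has an open seed: conditionally on the contact set, the `k`
selected seeds are disjoint sets of fresh vertices. [cite: KozmaNitzan2024, §4 p. 19 ((19))] -/
theorem real_manyContacts_diff_sGev_le [NeZero d] {j M k : ℕ} (hj : j ≤ R + 1)
    (hwide : ∀ k, L.Lo j k + 2 * M + 2 ≤ L.Hi j k) :
    (prodBernoulli w).real ((sFail L (LData.Ncont d M k) j)ᶜ \ sGev L j M k) ≤
      (1 - (p : ℝ) ^ siteSeedBound d M) ^ k := by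
  set μ := prodBernoulli w with hμ
  set N := LData.Ncont d M k with hN
  set OB := outerBoundary (zdGraph d) (L.X j) with hOB
  set Bκ : Finset (Site d) → Set (SiteConfig (Site d)) := fun κ => {ω | sKont L j ω = κ} with hBκ
  set Cx : Site d → Set (SiteConfig (Site d)) := fun x => (sSeedOpen L j M x)ᶜ with hCx
  set q : ℝ := 1 - (p : ℝ) ^ siteSeedBound d M with hq
  have hq0 : 0 ≤ q := by rw [hq, sub_nonneg]; exact pow_le_one₀ p.2.1 p.2.2
  -- covering
  have hcov : (sFail L N j)ᶜ \ sGev L j M k ⊆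
      ⋃ κ ∈ OB.powerset.filter (fun κ => N ≤ κ.card), (Bκ κ ∩ ⋂ x ∈ LData.selOf M k κ, Cx x) := by
    rintro ω ⟨hE, hG⟩
    simp only [sFail, Set.mem_compl_iff, Set.mem_setOf_eq, not_lt] at hE
    simp only [Set.mem_iUnion, Set.mem_iInter, Set.mem_inter_iff, Finset.mem_filter, Finset.mem_powerset,
      exists_prop, hBκ, hCx, Set.mem_setOf_eq, Set.mem_compl_iff]
    refine ⟨sKont L j ω, ⟨Finset.filter_subset _ _, hE⟩, rfl, fun x hx hseed => hG ?_⟩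
    simp only [sGev, Set.mem_iUnion, exists_prop]
    exact ⟨x, Finset.filter_subset _ _ (LData.selOf_subset _ hx), ⟨hx, hseed⟩⟩
  -- each piece
  have hBdet : ∀ κ, DeterminedBy (Bκ κ) (L.region j) := by
    intro κ; rw [determinedBy_iff]; intro ω ω' hω
    simp only [hBκ, Set.mem_setOf_eq, sKont_congr hω]
  have hBm : ∀ κ, MeasurableSet (Bκ κ) := fun κ => ((hBdet κ).mono (fun _ hz => hz.2)).measurableSet_of_finset
  have hCdet : ∀ x, DeterminedBy (Cx x) (↑(sSeed L j M x) : Set (Site d)) := by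
    intro x; rw [determinedBy_iff]; intro ω ω' hω
    simp only [hCx, Set.mem_compl_iff, sSeedOpen, Set.mem_setOf_eq]
    rw [show ((↑(sSeed L j M x) : Set (Site d)) ⊆ ω ↔ (↑(sSeed L j M x) : Set (Site d)) ⊆ ω') from ?_]
    constructor
    · intro h' z hz; have := Set.ext_iff.1 hω z; simp only [Set.mem_inter_iff] at this
      exact (this.1 ⟨h' hz, hz⟩).1
    · intro h' z hz; have := Set.ext_iff.1 hω z; simp only [Set.mem_inter_iff] at this
      exact (this.2 ⟨h' hz, hz⟩).1
  have hCm : ∀ x, MeasurableSet (Cx x) := fun x => (hCdet x).measurableSet_of_finset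
  have hCle : ∀ x ∈ OB, μ.real (Cx x) ≤ q := by
    intro x hx
    have hSm : MeasurableSet (sSeedOpen L j M x) := by
      have := hCm x; rw [hCx] at this; simpa using this.compl
    simp only [hCx]
    rw [measureReal_compl hSm, probReal_univ, hq]
    linarith [hL.le_real_sSeedOpen hj hwide hx]
  have hpiece : ∀ κ ∈ OB.powerset.filter (fun κ => N ≤ κ.card),
      μ.real (Bκ κ ∩ ⋂ x ∈ LData.selOf M k κ, Cx x) ≤ q ^ k * μ.real (Bκ κ) := by
    intro κ hκ
    obtain ⟨hκOB, hκN⟩ := Finset.mem_filter.1 hκ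
    rw [Finset.mem_powerset] at hκOB
    obtain ⟨hselκ, hcard, hsep⟩ := LData.selOf_spec (M := M) (k := k) hκN
    have hselOB : LData.selOf M k κ ⊆ OB := hselκ.trans hκOB
    have hdisj : (↑(LData.selOf M k κ) : Set (Site d)).PairwiseDisjoint (fun x => sSeed L j M x) := by
      intro x hx x' hx' hne
      exact sSeed_disjoint hwide (hselOB (Finset.mem_coe.1 hx)) (hselOB (Finset.mem_coe.1 hx'))
        (hsep x (Finset.mem_coe.1 hx) x' (Finset.mem_coe.1 hx') hne)
    have hA : DeterminedBy (Bκ κ) (⋃ x ∈ LData.selOf M k κ, (↑(sSeed L j M x) : Set (Site d)))ᶜ := by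
      refine (hBdet κ).mono fun z hz hmem => ?_
      simp only [Set.mem_iUnion, exists_prop, Finset.mem_coe] at hmem
      obtain ⟨x, hx, hzx⟩ := hmem
      exact hz.1 (Finset.mem_coe.2 (mem_sSeed hwide (hselOB hx) hzx).1)
    rw [hμ, prodBernoulli_real_inter_biInter_of_determinedBy w (LData.selOf M k κ) (fun x => sSeed L j M x) hdisj
      (fun x _ => hCdet x) (fun x _ => hCm x) hA (hBm κ), mul_comm]
    refine mul_le_mul_of_nonneg_right ?_ measureReal_nonneg
    calc ∏ x ∈ LData.selOf M k κ, (prodBernoulli w).real (Cx x) ≤ ∏ _x ∈ LData.selOf M k κ, q :=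
          Finset.prod_le_prod (fun x _ => measureReal_nonneg) fun x hx => hCle x (hselOB hx)
      _ = q ^ k := by rw [Finset.prod_const, hcard]
  have hdisjB : (↑(OB.powerset.filter (fun κ => N ≤ κ.card)) : Set (Finset (Site d))).PairwiseDisjoint Bκ := by
    intro κ _ κ' _ hne
    rw [Function.onFun, Set.disjoint_left]
    intro ω h1 h2
    exact hne (h1.symm.trans h2)
  calc μ.real ((sFail L N j)ᶜ \ sGev L j M k)
      ≤ μ.real (⋃ κ ∈ OB.powerset.filter (fun κ => N ≤ κ.card), (Bκ κ ∩ ⋂ x ∈ LData.selOf M k κ, Cx x)) :=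
        measureReal_mono hcov (measure_ne_top _ _)
    _ ≤ ∑ κ ∈ OB.powerset.filter (fun κ => N ≤ κ.card), μ.real (Bκ κ ∩ ⋂ x ∈ LData.selOf M k κ, Cx x) :=
        measureReal_biUnion_finset_le _ _
    _ ≤ ∑ κ ∈ OB.powerset.filter (fun κ => N ≤ κ.card), q ^ k * μ.real (Bκ κ) := Finset.sum_le_sum hpiece
    _ = q ^ k * μ.real (⋃ κ ∈ OB.powerset.filter (fun κ => N ≤ κ.card), Bκ κ) := by
        rw [← Finset.mul_sum, measureReal_biUnion_finset hdisjB (fun κ _ => hBm κ)]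
    _ ≤ q ^ k * 1 := mul_le_mul_of_nonneg_left measureReal_le_one (pow_nonneg hq0 k)
    _ = q ^ k := mul_one _

end SLHyp

end SiteKN

end Summit.CriticalPhenomena.PercolationContinuityZ3.Theorems.Transplant

end
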